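import Summits.QuantumFields.YangMills.Theorems.BalabanLadderUVSeamRecCarrierExpMomentsGlue
import HarnessLib

/-!
# Crux `UVSeamRec` (stmt-QuantumFields-20043), line `coldwall_pure`: the β-FREE («flat») classical carrier — glue

Helper file (`--supports stmt-QuantumFields-20043`) of the LEAD seat `ym-spine-20043-p1` (gen 18).

THE POINT (LEAD g18 finding, memo `FINDING-20043-g18-running-coupling.md`).  Every (β)-architecture cut of the crux (v6–v8, tempered-d1's
`GaussianDominationSU2`, the registered `stub_gaussianDomination` of `Lines/coldwall_pure.lean`, the RESHAPE-3 candidate `CarrierExpMomentsSU2`)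
weighs the classical centre response `cr` of a cube of radius `R+1` by the BARE coupling: `carrierCl C 1 β R = β·R⁴·cr/C`.  Under the torus
state the slow modes at scale `R` fluctuate with the RUNNING coupling `g²(R)`, so `⟨β R⁴ cr⟩ ≍ β g²(R) ≍ g²(R)/g₀²`, which at a fixed physical size
`R·uRec β = ℓ` grows like `β·g²_phys(ℓ)` (asymptotic freedom; `uRec` is the two-loop lattice unit).  Hence β-UNIFORM exponential-moment bounds for
the bare-weighted carrier on the whole femto window are (heuristically) FALSE, while the same bounds for the β-free carrier
`carrierCl C 1 1 R = R⁴·cr/C` (`⟨R⁴cr⟩ ≍ g²(R) ≤ g²_phys(ℓ₁)`) are consistent.  This file proves that the β-free carrier does everything the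
line asks of its two measure-side binders:

* §1 `carrierCl_eq_mul_carrierCl_one` (`carrierCl C s β R = β·carrierCl C s 1 R`), `carrierCl_one_eq_carrierCl_mul`, `carrierCl_one_le_carrierCl`;
* §2 `coldWallSplit_of_coldWallSplitFlat` — the flat cold-wall split (CW♭) «`(R⁴/C₁)|kerE^η(plane) − kerE^𝟙(plane)| ≤ A₂ + carrierCl C_s 1 1 R`»
  IMPLIES the registered sentence of `stub_coldWallSplit` (carrier `carrierCl C_s 1 β R`, threshold `max β₂ 1`);
* §3 `torusE_carrierCl_one_le_of_expMomentsFlat` — the flat binder (EM♭) «`⟨exp(2 Σ_{i∈T} carrierCl C 1 1 R)⟩_{2L+1,β} ≤ e^{B·#T}`» bounds the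
  torus MEAN of the flat carrier, `⟨carrierCl 1 1 1 R q x⟩_{2L+1,β} ≤ C·B/2` (Jensen);
* §4 `dirichletRate_of_coldWallSplitFlat_of_carrierMean`, `dirichletRateSU2_of_coldWallSplitFlat_of_expMomentsFlat` — (CW♭) ∧ (EM♭) ⇒ tempered-d1's
  `DirichletRateSU2` (torus DLR average of the payment inequality, LEAD g16's `abs_torusE_plane_sub_kerE_one_le` at the β-scaled constant `C_s·β`);
* §5 `responseMomentsOdd6SU2_of_coldWallSplitFlat_of_expMomentsFlat` — (CW♭) ∧ (EM♭) ⇒ the registered (RM) body `ResponseMomentsOdd6SU2`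
  (triangle through (DR), trivial tempering, the (RM) press `responseMoments_of_quadratic_and_influence` with the β-free `Q β R q x := carrierCl C' 1 1 R q x`).

So a reshape `{stub_coldWallSplitFemtoTail, stub_gaussianDomination} ↦ {(CW♭) on the femto tail, (EM♭)}` keeps `UVSeamRec_of` closed.
HONEST FRAMING: plumbing between conditional binders; (CW♭) on the tail and (EM♭) uniformly in `R` are OPEN (E0′-type); nothing of E0′, NT or
the gap is proved; YM mass gap NOT proved; not Clay.
-/

noncomputable section
open MeasureTheory Filter Topology Finset
open Literature.MathematicalPhysics.QuantumFieldTheory (LatticeRep)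
open Literature.MathematicalPhysics.QuantumLattice (fundamentalLatticeRep LGConfig)
open Summit.QuantumFields.YangMills.Cruxes.OSLegsFromFemtoAndGap.DlrCollarTransfer
open Summit.QuantumFields.YangMills.Cruxes.UVSeamRec
open Summit.QuantumFields.YangMills.Cruxes.UVSeamRec.ResponsePinning (torusE_mono torusE_const_mul' torusE_const)
open Summit.QuantumFields.YangMills.Cruxes.UVSeamRec.ResponseMomentsDefs (ResponseMomentsOdd6SU2)
open Summit.QuantumFields.YangMills.Cruxes.UVSeamRec.PolymerData Summit.QuantumFields.YangMills.Cruxes.UVSeamRec.TemperedResponse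

namespace Summit.QuantumFields.YangMills.Cruxes.UVSeamRec.ClassicalResponse

/-! ### §1 The flat carrier `carrierCl C s 1 R = R⁴·cr_s/C` versus the bare-weighted one `carrierCl C s β R = β·R⁴·cr_s/C` -/

section General

variable {G : Type} [Group G] [TopologicalSpace G] [IsTopologicalGroup G] [CompactSpace G]
  [MeasurableSpace G] [BorelSpace G] (r : LatticeRep G)

omit [IsTopologicalGroup G] [CompactSpace G] [BorelSpace G] in
/-- `carrierCl C s β R = β · carrierCl C s 1 R`: the bare-weighted carrier is `β` times the flat one. [folklore] -/
theorem carrierCl_eq_mul_carrierCl_one (C s β : ℝ) (R : ℕ) (q : Fin 4 × Fin 4) (x : Fin 4 → ℤ) (η : LGConfig 4 G) :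
    carrierCl r C s β R q x η = β * carrierCl r C s 1 R q x η := by
  unfold carrierCl
  ring

omit [IsTopologicalGroup G] [CompactSpace G] [BorelSpace G] in
/-- `carrierCl C s 1 R = carrierCl (C·β) s β R` for `β ≠ 0`: the flat carrier is the bare-weighted one at the β-scaled constant. [folklore] -/
theorem carrierCl_one_eq_carrierCl_mul (C s : ℝ) {β : ℝ} (hβ : β ≠ 0) (R : ℕ) (q : Fin 4 × Fin 4) (x : Fin 4 → ℤ) (η : LGConfig 4 G) :
    carrierCl r C s 1 R q x η = carrierCl r (C * β) s β R q x η := by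
  unfold carrierCl
  by_cases hC : C = 0
  · subst hC; simp
  · field_simp

omit [BorelSpace G] in
/-- For `β ≥ 1`, `C > 0`, `s > 0` the flat carrier is below the bare-weighted one. [folklore] -/
theorem carrierCl_one_le_carrierCl {C s β : ℝ} (hC : 0 < C) (hs : 0 < s) (hβ : 1 ≤ β) (R : ℕ) (q : Fin 4 × Fin 4) (x : Fin 4 → ℤ)
    (η : LGConfig 4 G) : carrierCl r C s 1 R q x η ≤ carrierCl r C s β R q x η := by
  rw [carrierCl_eq_mul_carrierCl_one r C s β]
  exact le_mul_of_one_le_left (carrierCl_nonneg hC hs zero_le_one R q x η) hβ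

end General

/-! ### §2 (CW♭) implies the registered (CW) -/

section SU2

/-- **The flat cold-wall split implies the registered one.**  If `(R⁴/C₁)|kerE^η(plane q x) − kerE^𝟙(plane q x)| ≤ A₂ + carrierCl C_s 1 1 R q x η` on
the femto window from `β₂`, then the sentence of `stub_coldWallSplit` (carrier `carrierCl C_s 1 β R`) holds from `max β₂ 1`. [folklore] -/
theorem coldWallSplit_of_coldWallSplitFlat
    (h : ∃ (C_s C₁ A₂ β₂ ℓ₂ : ℝ), 0 < C_s ∧ 0 < C₁ ∧ 0 ≤ A₂ ∧ 0 < ℓ₂ ∧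
      ∀ β : ℝ, β₂ ≤ β → ∀ R : ℕ, 1 ≤ R → (R : ℝ) * Transport.uRec β ≤ ℓ₂ →
      ∀ (q : Fin 4 × Fin 4) (x : Fin 4 → ℤ), q.1 < q.2 → ∀ η : LGConfig 4 (Matrix.specialUnitaryGroup (Fin 2) ℂ),
      (R : ℝ) ^ 4 / C₁ * |kerE (Matrix.specialUnitaryGroup (Fin 2) ℂ) (fundamentalLatticeRep 2) β (fun k => x k - (R + 1)) (2 * R + 3) η
          (plane (Matrix.specialUnitaryGroup (Fin 2) ℂ) (fundamentalLatticeRep 2) q x) -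
        kerE (Matrix.specialUnitaryGroup (Fin 2) ℂ) (fundamentalLatticeRep 2) β (fun k => x k - (R + 1)) (2 * R + 3) 1
          (plane (Matrix.specialUnitaryGroup (Fin 2) ℂ) (fundamentalLatticeRep 2) q x)| ≤
        A₂ + carrierCl (fundamentalLatticeRep 2) C_s 1 1 R q x η) :
    ∃ (C_s C₁ A₂ β₂ ℓ₂ : ℝ), 0 < C_s ∧ 0 < C₁ ∧ 0 ≤ A₂ ∧ 0 < ℓ₂ ∧
      ∀ β : ℝ, β₂ ≤ β → ∀ R : ℕ, 1 ≤ R → (R : ℝ) * Transport.uRec β ≤ ℓ₂ →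
      ∀ (q : Fin 4 × Fin 4) (x : Fin 4 → ℤ), q.1 < q.2 → ∀ η : LGConfig 4 (Matrix.specialUnitaryGroup (Fin 2) ℂ),
      (R : ℝ) ^ 4 / C₁ * |kerE (Matrix.specialUnitaryGroup (Fin 2) ℂ) (fundamentalLatticeRep 2) β (fun k => x k - (R + 1)) (2 * R + 3) η
          (plane (Matrix.specialUnitaryGroup (Fin 2) ℂ) (fundamentalLatticeRep 2) q x) -
        kerE (Matrix.specialUnitaryGroup (Fin 2) ℂ) (fundamentalLatticeRep 2) β (fun k => x k - (R + 1)) (2 * R + 3) 1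
          (plane (Matrix.specialUnitaryGroup (Fin 2) ℂ) (fundamentalLatticeRep 2) q x)| ≤
        A₂ + carrierCl (fundamentalLatticeRep 2) C_s 1 β R q x η := by
  obtain ⟨C_s, C₁, A₂, β₂, ℓ₂, hCs, hC₁, hA₂, hℓ₂, h⟩ := h
  refine ⟨C_s, C₁, A₂, max β₂ 1, ℓ₂, hCs, hC₁, hA₂, hℓ₂, fun β hβ R hR hRu q x hq η => ?_⟩
  exact (h β ((le_max_left _ _).trans hβ) R hR hRu q x hq η).trans
    (add_le_add le_rfl (carrierCl_one_le_carrierCl (fundamentalLatticeRep 2) hCs one_pos ((le_max_right _ _).trans hβ) R q x η))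

/-! ### §3 The flat binder bounds the torus mean of the flat carrier -/

/-- **The flat carrier MEAN from (EM♭)** (Jensen): if `⟨exp(2 Σ_{i∈T} carrierCl C 1 1 R (q i) (x i))⟩_{2L+1,β} ≤ e^{B·#T}` for the admissible families
at `(β, R, L)`, then for the one-member family `⟨carrierCl 1 1 1 R q x⟩_{2L+1,β} ≤ C·B/2` (`carrierCl 1 = C·carrierCl C`). [folklore] -/
theorem torusE_carrierCl_one_le_of_expMomentsFlat {C B β : ℝ} (hC : 0 < C) {L R : ℕ} (q : Fin 4 × Fin 4) (x : Fin 4 → ℤ)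
    (h : ∀ (n : ℕ) (q : Fin n → Fin 4 × Fin 4) (x : Fin n → (Fin 4 → ℤ)), (∀ i, (q i).1 < (q i).2) →
      (∀ i j : Fin n, i ≠ j → ∃ k : Fin 4,
        (2 * (R : ℤ) + 4) ≤ |((((x i k - x j k : ℤ) : ZMod (2 * L + 1))).valMinAbs : ℤ)|) →
      ∀ T : Finset (Fin n),
        torusE (Matrix.specialUnitaryGroup (Fin 2) ℂ) (fundamentalLatticeRep 2) β L
          (fun U => Real.exp (((2 : ℕ) : ℝ) * ∑ i ∈ T, carrierCl (fundamentalLatticeRep 2) C 1 1 R (q i) (x i) U)) ≤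
          Real.exp (B * T.card))
    (hq : q.1 < q.2) :
    torusE (Matrix.specialUnitaryGroup (Fin 2) ℂ) (fundamentalLatticeRep 2) β L
        (carrierCl (fundamentalLatticeRep 2) 1 1 1 R q x) ≤ C * B / 2 := by
  set rF : LatticeRep (Matrix.specialUnitaryGroup (Fin 2) ℂ) := fundamentalLatticeRep 2 with hrF
  have h1 := h 1 (fun _ => q) (fun _ => x) (fun _ => hq) (fun i j hij => absurd (Subsingleton.elim i j) hij) Finset.univ
  simp only [univ_unique, sum_singleton, card_singleton, Nat.cast_one, mul_one] at h1
  have hcQ : Continuous (carrierCl rF C 1 1 R q x) := continuous_const.mul (continuous_classicalResponse (r := rF) _ _ q x 1)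
  have hcA : Continuous fun U : LGConfig 4 (Matrix.specialUnitaryGroup (Fin 2) ℂ) => ((2 : ℕ) : ℝ) * carrierCl rF C 1 1 R q x U :=
    continuous_const.mul hcQ
  have hpos : 0 < torusE (Matrix.specialUnitaryGroup (Fin 2) ℂ) rF β L
      (fun U => Real.exp (((2 : ℕ) : ℝ) * carrierCl rF C 1 1 R q x U)) := by
    have h1le : torusE (Matrix.specialUnitaryGroup (Fin 2) ℂ) rF β L (fun _ => (1 : ℝ)) ≤
        torusE (Matrix.specialUnitaryGroup (Fin 2) ℂ) rF β L (fun U => Real.exp (((2 : ℕ) : ℝ) * carrierCl rF C 1 1 R q x U)) :=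
      torusE_mono rF β L continuous_const (Real.continuous_exp.comp hcA) fun U =>
        Real.one_le_exp (mul_nonneg (by positivity) (carrierCl_nonneg hC one_pos zero_le_one R q x U))
    rw [torusE_const] at h1le
    linarith
  have hJ : torusE (Matrix.specialUnitaryGroup (Fin 2) ℂ) rF β L (fun U => ((2 : ℕ) : ℝ) * carrierCl rF C 1 1 R q x U) ≤ B := by
    refine (torusE_le_log_torusE_exp rF β L hcA).trans ?_
    rw [Real.log_le_iff_le_exp hpos]
    exact h1
  rw [torusE_const_mul'] at hJ
  have h3 : carrierCl rF 1 1 1 R q x = fun U => C * carrierCl rF C 1 1 R q x U := by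
    funext U
    rw [carrierCl_eq_mul rF C 1 1 1 hC.ne', div_one]
  rw [h3, torusE_const_mul']
  push_cast at hJ
  nlinarith [hJ, hC]

/-! ### §4 (CW♭) ∧ (EM♭) ⇒ (DR) -/

/-- **(CW♭) ∧ flat carrier mean ⇒ (DR)**: the torus DLR average of the flat payment inequality (LEAD g16's `abs_torusE_plane_sub_kerE_one_le`
at the β-scaled constant `C_s·β`, using `carrierCl C_s 1 1 R = carrierCl (C_s β) 1 β R` and `⟨carrierCl 1 1 β R⟩ = β⟨carrierCl 1 1 1 R⟩`):
for `β ≥ max β₂ (max β₃ 1)`, `R·uRec β ≤ min ℓ₂ ℓ₃`, reference = the plane mean of the torus `2(4⌈ℓ/uRec β⌉+8)+1`,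
`(R⁴/C₁)|kerE^𝟙(plane q x) − p q β| ≤ A₂ + A₃/C_s` — a β-UNIFORM tolerance from β-UNIFORM flat data. [folklore] -/
theorem dirichletRate_of_coldWallSplitFlat_of_carrierMean {C_s C₁ A₂ β₂ ℓ₂ A₃ β₃ ℓ₃ : ℝ} (hCs : 0 < C_s) (hC₁ : 0 < C₁)
    (hCW : ∀ β : ℝ, β₂ ≤ β → ∀ R : ℕ, 1 ≤ R → (R : ℝ) * Transport.uRec β ≤ ℓ₂ →
      ∀ (q : Fin 4 × Fin 4) (x : Fin 4 → ℤ), q.1 < q.2 → ∀ η : LGConfig 4 (Matrix.specialUnitaryGroup (Fin 2) ℂ),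
      (R : ℝ) ^ 4 / C₁ * |kerE (Matrix.specialUnitaryGroup (Fin 2) ℂ) (fundamentalLatticeRep 2) β (fun k => x k - (R + 1)) (2 * R + 3) η
          (plane (Matrix.specialUnitaryGroup (Fin 2) ℂ) (fundamentalLatticeRep 2) q x) -
        kerE (Matrix.specialUnitaryGroup (Fin 2) ℂ) (fundamentalLatticeRep 2) β (fun k => x k - (R + 1)) (2 * R + 3) 1
          (plane (Matrix.specialUnitaryGroup (Fin 2) ℂ) (fundamentalLatticeRep 2) q x)| ≤
        A₂ + carrierCl (fundamentalLatticeRep 2) C_s 1 1 R q x η)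
    (hCM : ∀ β : ℝ, β₃ ≤ β → ∀ (L R : ℕ) (q : Fin 4 × Fin 4) (x : Fin 4 → ℤ), q.1 < q.2 → 1 ≤ R →
      (R : ℝ) * Transport.uRec β ≤ ℓ₃ → 4 * R + 8 ≤ L →
      torusE (Matrix.specialUnitaryGroup (Fin 2) ℂ) (fundamentalLatticeRep 2) β L
        (carrierCl (fundamentalLatticeRep 2) 1 1 1 R q x) ≤ A₃) :
    DirichletRate C₁ (A₂ + A₃ / C_s) (max β₂ (max β₃ 1)) (min ℓ₂ ℓ₃) fun q β =>
      torusE (Matrix.specialUnitaryGroup (Fin 2) ℂ) (fundamentalLatticeRep 2) β (4 * ⌈min ℓ₂ ℓ₃ / Transport.uRec β⌉₊ + 8)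
        (plane (Matrix.specialUnitaryGroup (Fin 2) ℂ) (fundamentalLatticeRep 2) q 0) := by
  intro β hβ R hR hRu q x hq
  set G₂ := Matrix.specialUnitaryGroup (Fin 2) ℂ
  set rF : LatticeRep G₂ := fundamentalLatticeRep 2
  set L : ℕ := 4 * ⌈min ℓ₂ ℓ₃ / Transport.uRec β⌉₊ + 8 with hL
  have hβ₂ : β₂ ≤ β := (le_max_left _ _).trans hβ
  have hβ₃ : β₃ ≤ β := (le_max_left _ _).trans ((le_max_right _ _).trans hβ)
  have hβ1 : 1 ≤ β := (le_max_right _ _).trans ((le_max_right _ _).trans hβ)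
  have hβ0 : 0 < β := by linarith
  have hu := Summit.QuantumFields.YangMills.Cruxes.UVSeamRec.UnitTransfer.uRec_pos β
  have hRceil : R ≤ ⌈min ℓ₂ ℓ₃ / Transport.uRec β⌉₊ := by
    have h1 : (R : ℝ) ≤ min ℓ₂ ℓ₃ / Transport.uRec β := (le_div_iff₀ hu).2 hRu
    exact_mod_cast h1.trans (Nat.le_ceil _)
  have hRL : 4 * R + 8 ≤ L := by rw [hL]; omega
  have hRu₂ : (R : ℝ) * Transport.uRec β ≤ ℓ₂ := hRu.trans (min_le_left _ _)
  have hRu₃ : (R : ℝ) * Transport.uRec β ≤ ℓ₃ := hRu.trans (min_le_right _ _)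
  -- the flat hypotheses at `β`, rewritten at the β-scaled constant
  have hCsβ : 0 < C_s * β := mul_pos hCs hβ0
  have hCW' : ∀ η : LGConfig 4 G₂,
      (R : ℝ) ^ 4 / C₁ * |kerE G₂ rF β (fun k => (0 : Fin 4 → ℤ) k - (R + 1)) (2 * R + 3) η (plane G₂ rF q 0) -
        kerE G₂ rF β (fun k => (0 : Fin 4 → ℤ) k - (R + 1)) (2 * R + 3) 1 (plane G₂ rF q 0)| ≤
        A₂ + carrierCl rF (C_s * β) 1 β R q 0 η := fun η => by
    have h0 := hCW β hβ₂ R hR hRu₂ q 0 hq η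
    rwa [carrierCl_one_eq_carrierCl_mul rF C_s 1 hβ0.ne'] at h0
  have hCM' : torusE G₂ rF β L (carrierCl rF 1 1 β R q 0) ≤ β * A₃ := by
    have e : carrierCl rF 1 1 β R q 0 = fun U => β * carrierCl rF 1 1 1 R q 0 U := by
      funext U; exact carrierCl_eq_mul_carrierCl_one rF 1 1 β R q 0 U
    rw [e, torusE_const_mul']
    exact mul_le_mul_of_nonneg_left (hCM β hβ₃ L R q 0 hq hR hRu₃ hRL) hβ0.le
  have key := abs_torusE_plane_sub_kerE_one_le (β := β) hCsβ hC₁ hR (by omega : R + 2 ≤ L) q 0 hCW' hCM'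
  have hsimp : A₂ + β * A₃ / (C_s * β) = A₂ + A₃ / C_s := by
    field_simp
  rw [hsimp] at key
  -- move the cold-wall kernel from `x` to `0`
  have htr : kerE G₂ rF β (fun k => x k - (R + 1)) (2 * R + 3) 1 (plane G₂ rF q x) =
      kerE G₂ rF β (fun k => (0 : Fin 4 → ℤ) k - (R + 1)) (2 * R + 3) 1 (plane G₂ rF q 0) :=
    kerE_plane_trivialExterior_eq rF β q x R
  rw [htr, abs_sub_comm]
  have hR0 : (0 : ℝ) < R := by exact_mod_cast (show 0 < R by omega)
  have hR4 : 0 < (R : ℝ) ^ 4 / C₁ := by positivity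
  rw [← le_div_iff₀' hR4]
  have e : (A₂ + A₃ / C_s) / ((R : ℝ) ^ 4 / C₁) = C₁ / (R : ℝ) ^ 4 * (A₂ + A₃ / C_s) := by
    field_simp
  rw [e]
  exact key

/-- **(CW♭) ∧ (EM♭) ⇒ (DR)** — tempered-d1's `DirichletRateSU2` from the two FLAT binders (tolerance `A₂ + C·B/(2C_s)`, reference values = plaquette
means of one big torus per `β`, bound `P₀` = the sup of the plane field). [folklore] -/
theorem dirichletRateSU2_of_coldWallSplitFlat_of_expMomentsFlat
    (hCW : ∃ (C_s C₁ A₂ β₂ ℓ₂ : ℝ), 0 < C_s ∧ 0 < C₁ ∧ 0 ≤ A₂ ∧ 0 < ℓ₂ ∧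
      ∀ β : ℝ, β₂ ≤ β → ∀ R : ℕ, 1 ≤ R → (R : ℝ) * Transport.uRec β ≤ ℓ₂ →
      ∀ (q : Fin 4 × Fin 4) (x : Fin 4 → ℤ), q.1 < q.2 → ∀ η : LGConfig 4 (Matrix.specialUnitaryGroup (Fin 2) ℂ),
      (R : ℝ) ^ 4 / C₁ * |kerE (Matrix.specialUnitaryGroup (Fin 2) ℂ) (fundamentalLatticeRep 2) β (fun k => x k - (R + 1)) (2 * R + 3) η
          (plane (Matrix.specialUnitaryGroup (Fin 2) ℂ) (fundamentalLatticeRep 2) q x) -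
        kerE (Matrix.specialUnitaryGroup (Fin 2) ℂ) (fundamentalLatticeRep 2) β (fun k => x k - (R + 1)) (2 * R + 3) 1
          (plane (Matrix.specialUnitaryGroup (Fin 2) ℂ) (fundamentalLatticeRep 2) q x)| ≤
        A₂ + carrierCl (fundamentalLatticeRep 2) C_s 1 1 R q x η)
    (hEM : ∃ (C B β₁ ℓ₁ : ℝ), 0 < C ∧ 0 < ℓ₁ ∧
      ∀ β : ℝ, β₁ ≤ β → ∀ (L n : ℕ) (q : Fin n → Fin 4 × Fin 4) (x : Fin n → (Fin 4 → ℤ)) (R : ℕ),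
      (∀ i, (q i).1 < (q i).2) → 1 ≤ R → (R : ℝ) * Transport.uRec β ≤ ℓ₁ → 4 * R + 8 ≤ L →
      (∀ i j : Fin n, i ≠ j → ∃ k : Fin 4,
        (2 * (R : ℤ) + 4) ≤ |((((x i k - x j k : ℤ) : ZMod (2 * L + 1))).valMinAbs : ℤ)|) →
      ∀ T : Finset (Fin n),
        torusE (Matrix.specialUnitaryGroup (Fin 2) ℂ) (fundamentalLatticeRep 2) β L
          (fun U => Real.exp (((2 : ℕ) : ℝ) * ∑ i ∈ T, carrierCl (fundamentalLatticeRep 2) C 1 1 R (q i) (x i) U)) ≤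
          Real.exp (B * T.card)) :
    DirichletRateSU2 := by
  obtain ⟨C_s, C₁, A₂, β₂, ℓ₂, hCs, hC₁, hA₂, hℓ₂, hCW⟩ := hCW
  obtain ⟨C, B, β₁, ℓ₁, hC, hℓ₁, hEM⟩ := hEM
  obtain ⟨P₀, hP₀⟩ := exists_abs_plane_le (G := Matrix.specialUnitaryGroup (Fin 2) ℂ) (fundamentalLatticeRep 2)
  have hCM : ∀ β : ℝ, β₁ ≤ β → ∀ (L R : ℕ) (q : Fin 4 × Fin 4) (x : Fin 4 → ℤ), q.1 < q.2 → 1 ≤ R →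
      (R : ℝ) * Transport.uRec β ≤ ℓ₁ → 4 * R + 8 ≤ L →
      torusE (Matrix.specialUnitaryGroup (Fin 2) ℂ) (fundamentalLatticeRep 2) β L
        (carrierCl (fundamentalLatticeRep 2) 1 1 1 R q x) ≤ max (C * B / 2) 0 :=
    fun β hβ L R q x hq hR hRu hRL =>
      (torusE_carrierCl_one_le_of_expMomentsFlat hC q x
        (fun n q' x' hq' hsep T => hEM β hβ L n q' x' R hq' hR hRu hRL hsep T) hq).trans (le_max_left _ _)
  have hDR := dirichletRate_of_coldWallSplitFlat_of_carrierMean hCs hC₁ hCW hCM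
  have hp : ∀ (q : Fin 4 × Fin 4) (β : ℝ),
      |torusE (Matrix.specialUnitaryGroup (Fin 2) ℂ) (fundamentalLatticeRep 2) β (4 * ⌈min ℓ₂ ℓ₁ / Transport.uRec β⌉₊ + 8)
        (plane (Matrix.specialUnitaryGroup (Fin 2) ℂ) (fundamentalLatticeRep 2) q 0)| ≤ P₀ := fun q β => by
    have h := ResponsePinning.abs_torusE_sub_le_of_forall (fundamentalLatticeRep 2) β
      (4 * ⌈min ℓ₂ ℓ₁ / Transport.uRec β⌉₊ + 8) (continuous_plane (fundamentalLatticeRep 2) q 0) (c := 0) (h := P₀)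
      (fun U => by rw [sub_zero]; exact hP₀ q 0 U)
    rwa [sub_zero] at h
  exact ⟨C₁, A₂ + max (C * B / 2) 0 / C_s, P₀, max β₂ (max β₁ 1), min ℓ₂ ℓ₁, _, hC₁, by positivity,
    lt_min hℓ₂ hℓ₁, hp, hDR⟩

/-! ### §5 (CW♭) ∧ (EM♭) ⇒ (RM) -/

/-- **(CW♭) ∧ (EM♭) ⇒ the registered (RM) body `ResponseMomentsOdd6SU2`.**  Triangle through (DR) (§4: `(R⁴/C₁)|kerE^η(plane) − p| ≤
(2A₂ + A₃/C_s) + carrierCl C_s 1 1 R`), rescale to the common constant `C' = max C_s C` (`C₁ ↦ C₁C'/C_s`), temper trivially (`𝔟 = 3`, `ε ≡ 3`,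
`kmax ≡ 0`: `influenceAt ≡ 0`, (EM_I) with `B_I = 0`), and press with `responseMoments_of_quadratic_and_influence` (p541348) at the β-FREE
carrier `Q β R q x := carrierCl C' 1 1 R q x`. [folklore] -/
theorem responseMomentsOdd6SU2_of_coldWallSplitFlat_of_expMomentsFlat
    (hCW : ∃ (C_s C₁ A₂ β₂ ℓ₂ : ℝ), 0 < C_s ∧ 0 < C₁ ∧ 0 ≤ A₂ ∧ 0 < ℓ₂ ∧
      ∀ β : ℝ, β₂ ≤ β → ∀ R : ℕ, 1 ≤ R → (R : ℝ) * Transport.uRec β ≤ ℓ₂ →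
      ∀ (q : Fin 4 × Fin 4) (x : Fin 4 → ℤ), q.1 < q.2 → ∀ η : LGConfig 4 (Matrix.specialUnitaryGroup (Fin 2) ℂ),
      (R : ℝ) ^ 4 / C₁ * |kerE (Matrix.specialUnitaryGroup (Fin 2) ℂ) (fundamentalLatticeRep 2) β (fun k => x k - (R + 1)) (2 * R + 3) η
          (plane (Matrix.specialUnitaryGroup (Fin 2) ℂ) (fundamentalLatticeRep 2) q x) -
        kerE (Matrix.specialUnitaryGroup (Fin 2) ℂ) (fundamentalLatticeRep 2) β (fun k => x k - (R + 1)) (2 * R + 3) 1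
          (plane (Matrix.specialUnitaryGroup (Fin 2) ℂ) (fundamentalLatticeRep 2) q x)| ≤
        A₂ + carrierCl (fundamentalLatticeRep 2) C_s 1 1 R q x η)
    (hEM : ∃ (C B β₁ ℓ₁ : ℝ), 0 < C ∧ 0 < ℓ₁ ∧
      ∀ β : ℝ, β₁ ≤ β → ∀ (L n : ℕ) (q : Fin n → Fin 4 × Fin 4) (x : Fin n → (Fin 4 → ℤ)) (R : ℕ),
      (∀ i, (q i).1 < (q i).2) → 1 ≤ R → (R : ℝ) * Transport.uRec β ≤ ℓ₁ → 4 * R + 8 ≤ L →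
      (∀ i j : Fin n, i ≠ j → ∃ k : Fin 4,
        (2 * (R : ℤ) + 4) ≤ |((((x i k - x j k : ℤ) : ZMod (2 * L + 1))).valMinAbs : ℤ)|) →
      ∀ T : Finset (Fin n),
        torusE (Matrix.specialUnitaryGroup (Fin 2) ℂ) (fundamentalLatticeRep 2) β L
          (fun U => Real.exp (((2 : ℕ) : ℝ) * ∑ i ∈ T, carrierCl (fundamentalLatticeRep 2) C 1 1 R (q i) (x i) U)) ≤
          Real.exp (B * T.card)) :
    ResponseMomentsOdd6SU2 := by
  obtain ⟨C_s, C₁, A₂, β₂, ℓ₂, hCs, hC₁, hA₂, hℓ₂, hCW⟩ := hCW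
  obtain ⟨C, B, β₁, ℓ₁, hC, hℓ₁, hEM⟩ := hEM
  obtain ⟨P₀, hP₀⟩ := exists_abs_plane_le (G := Matrix.specialUnitaryGroup (Fin 2) ℂ) (fundamentalLatticeRep 2)
  set rF : LatticeRep (Matrix.specialUnitaryGroup (Fin 2) ℂ) := fundamentalLatticeRep 2 with hrF
  -- the flat carrier mean and (DR)
  set A₃ : ℝ := max (C * B / 2) 0 with hA₃
  have hA₃0 : 0 ≤ A₃ := le_max_right _ _
  have hCM : ∀ β : ℝ, β₁ ≤ β → ∀ (L R : ℕ) (q : Fin 4 × Fin 4) (x : Fin 4 → ℤ), q.1 < q.2 → 1 ≤ R →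
      (R : ℝ) * Transport.uRec β ≤ ℓ₁ → 4 * R + 8 ≤ L →
      torusE (Matrix.specialUnitaryGroup (Fin 2) ℂ) rF β L (carrierCl rF 1 1 1 R q x) ≤ A₃ :=
    fun β hβ L R q x hq hR hRu hRL =>
      (torusE_carrierCl_one_le_of_expMomentsFlat hC q x
        (fun n q' x' hq' hsep T => hEM β hβ L n q' x' R hq' hR hRu hRL hsep T) hq).trans (le_max_left _ _)
  have hDR := dirichletRate_of_coldWallSplitFlat_of_carrierMean hCs hC₁ hCW hCM
  set p : Fin 4 × Fin 4 → ℝ → ℝ := fun q β =>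
    torusE (Matrix.specialUnitaryGroup (Fin 2) ℂ) rF β (4 * ⌈min ℓ₂ ℓ₁ / Transport.uRec β⌉₊ + 8) (plane _ rF q 0) with hpdef
  have hp : ∀ (q : Fin 4 × Fin 4) (β : ℝ), |p q β| ≤ P₀ := fun q β => by
    have h := ResponsePinning.abs_torusE_sub_le_of_forall rF β
      (4 * ⌈min ℓ₂ ℓ₁ / Transport.uRec β⌉₊ + 8) (continuous_plane rF q 0) (c := 0) (h := P₀)
      (fun U => by rw [sub_zero]; exact hP₀ q 0 U)
    rwa [sub_zero] at h
  -- common constant and guards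
  set C' : ℝ := max C_s C with hC'def
  have hCsC : C_s ≤ C' := le_max_left _ _
  have hCC : C ≤ C' := le_max_right _ _
  have hC'pos : 0 < C' := hCs.trans_le hCsC
  set β₀ : ℝ := max β₂ (max β₁ 1) with hβ₀
  have hβ₀₂ : β₂ ≤ β₀ := le_max_left _ _
  have hβ₀₁ : β₁ ≤ β₀ := (le_max_left _ _).trans (le_max_right _ _)
  set ℓ₀ : ℝ := min ℓ₂ ℓ₁ with hℓ₀
  have hℓ₀pos : 0 < ℓ₀ := lt_min hℓ₂ hℓ₁
  -- trivial tempering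
  have h3 : ∀ (_β : ℝ) (_k : ℕ), (2 : ℝ) < 3 := fun _ _ => by norm_num
  have hEMI := emi_of_two_lt BlockSize.three (ε := fun _ _ => 3) h3 (fun _ _ => 0) β₀ ℓ₀
  -- the split against the reference, at the common constant
  have hsplit : ∀ β : ℝ, β₀ ≤ β → ∀ R : ℕ, 1 ≤ R → (R : ℝ) * Transport.uRec β ≤ ℓ₀ →
      ∀ (q : Fin 4 × Fin 4) (x : Fin 4 → ℤ), q.1 < q.2 → ∀ η : LGConfig 4 (Matrix.specialUnitaryGroup (Fin 2) ℂ),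
        (R : ℝ) ^ 4 / (C₁ * C' / C_s) * |kerE (Matrix.specialUnitaryGroup (Fin 2) ℂ) rF β (fun k => x k - (R + 1)) (2 * R + 3) η
          (plane (Matrix.specialUnitaryGroup (Fin 2) ℂ) rF q x) - p q β| ≤
          (A₂ + (A₂ + A₃ / C_s)) + carrierCl rF C' 1 1 R q x η +
            influenceAt (N := 2) BlockSize.three (fun _ _ => 3) (fun _ _ => 0) β R q x η := by
    intro β hβ R hR hRu q x hq η
    have hcw := hCW β (hβ₀₂.trans hβ) R hR (hRu.trans (min_le_left _ _)) q x hq η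
    have hdr := hDR β hβ R hR hRu q x hq
    have hI : 0 ≤ influenceAt (N := 2) BlockSize.three (fun _ _ => 3) (fun _ _ => 0) β R q x η :=
      influenceAt_nonneg (N := 2) _ _ _ β R q x η
    have hR4 : 0 ≤ (R : ℝ) ^ 4 / C₁ := by positivity
    -- triangle
    have htri : (R : ℝ) ^ 4 / C₁ * |kerE (Matrix.specialUnitaryGroup (Fin 2) ℂ) rF β (fun k => x k - (R + 1)) (2 * R + 3) η
          (plane (Matrix.specialUnitaryGroup (Fin 2) ℂ) rF q x) - p q β| ≤
        (A₂ + (A₂ + A₃ / C_s)) + carrierCl rF C_s 1 1 R q x η := by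
      have habs : |kerE (Matrix.specialUnitaryGroup (Fin 2) ℂ) rF β (fun k => x k - (R + 1)) (2 * R + 3) η
            (plane (Matrix.specialUnitaryGroup (Fin 2) ℂ) rF q x) - p q β| ≤
          |kerE (Matrix.specialUnitaryGroup (Fin 2) ℂ) rF β (fun k => x k - (R + 1)) (2 * R + 3) η
              (plane (Matrix.specialUnitaryGroup (Fin 2) ℂ) rF q x) -
            kerE (Matrix.specialUnitaryGroup (Fin 2) ℂ) rF β (fun k => x k - (R + 1)) (2 * R + 3) 1
              (plane (Matrix.specialUnitaryGroup (Fin 2) ℂ) rF q x)| +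
          |kerE (Matrix.specialUnitaryGroup (Fin 2) ℂ) rF β (fun k => x k - (R + 1)) (2 * R + 3) 1
              (plane (Matrix.specialUnitaryGroup (Fin 2) ℂ) rF q x) - p q β| := abs_sub_le _ _ _
      have := mul_le_mul_of_nonneg_left habs hR4
      rw [mul_add] at this
      linarith
    -- rescale `C_s ↦ C'`
    have hratio : C_s / C' ≤ 1 := (div_le_one hC'pos).2 hCsC
    have hratio0 : 0 ≤ C_s / C' := by positivity
    have h1 : (R : ℝ) ^ 4 / (C₁ * C' / C_s) * |kerE (Matrix.specialUnitaryGroup (Fin 2) ℂ) rF β (fun k => x k - (R + 1)) (2 * R + 3) η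
          (plane (Matrix.specialUnitaryGroup (Fin 2) ℂ) rF q x) - p q β| =
        C_s / C' * ((R : ℝ) ^ 4 / C₁ * |kerE (Matrix.specialUnitaryGroup (Fin 2) ℂ) rF β (fun k => x k - (R + 1)) (2 * R + 3) η
          (plane (Matrix.specialUnitaryGroup (Fin 2) ℂ) rF q x) - p q β|) := by
      field_simp
    rw [h1]
    have h2 := mul_le_mul_of_nonneg_left htri hratio0
    have h3' : C_s / C' * ((A₂ + (A₂ + A₃ / C_s)) + carrierCl rF C_s 1 1 R q x η) =
        C_s / C' * (A₂ + (A₂ + A₃ / C_s)) + carrierCl rF C' 1 1 R q x η := by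
      rw [carrierCl_eq_mul rF C_s C' 1 1 hCs.ne']
      ring
    rw [h3'] at h2
    have hK0 : 0 ≤ A₂ + (A₂ + A₃ / C_s) := by positivity
    have h4 : C_s / C' * (A₂ + (A₂ + A₃ / C_s)) ≤ A₂ + (A₂ + A₃ / C_s) := mul_le_of_le_one_left hK0 hratio
    linarith
  -- (EM♭) at the common constant
  have hEMQ : ∀ β : ℝ, β₀ ≤ β → ∀ (L n : ℕ) (q : Fin n → Fin 4 × Fin 4) (x : Fin n → (Fin 4 → ℤ)) (R : ℕ),
      (∀ i, (q i).1 < (q i).2) → 1 ≤ R → (R : ℝ) * Transport.uRec β ≤ ℓ₀ → 4 * R + 8 ≤ L →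
      (∀ i j : Fin n, i ≠ j → ∃ k : Fin 4,
        (2 * (R : ℤ) + 4) ≤ |((((x i k - x j k : ℤ) : ZMod (2 * L + 1))).valMinAbs : ℤ)|) →
      ∀ T : Finset (Fin n),
        torusE (Matrix.specialUnitaryGroup (Fin 2) ℂ) rF β L
          (fun U => Real.exp (((2 : ℕ) : ℝ) * ∑ i ∈ T, carrierCl rF C' 1 1 R (q i) (x i) U)) ≤ Real.exp (B * T.card) := by
    intro β hβ L n q x R hq hR hRu hRL hsep T
    have h0 := hEM β (hβ₀₁.trans hβ) L n q x R hq hR (hRu.trans (min_le_right _ _)) hRL hsep T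
    have hpt : ∀ U : LGConfig 4 (Matrix.specialUnitaryGroup (Fin 2) ℂ),
        Real.exp (((2 : ℕ) : ℝ) * ∑ i ∈ T, carrierCl rF C' 1 1 R (q i) (x i) U) ≤
          Real.exp (((2 : ℕ) : ℝ) * ∑ i ∈ T, carrierCl rF C 1 1 R (q i) (x i) U) := by
      intro U
      refine Real.exp_le_exp.2 (mul_le_mul_of_nonneg_left (sum_le_sum fun i _ => ?_) (by positivity))
      rw [carrierCl_eq_mul rF C C' 1 1 hC.ne']
      have hr : C / C' ≤ 1 := (div_le_one hC'pos).2 hCC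
      exact mul_le_of_le_one_left (carrierCl_nonneg hC one_pos zero_le_one R (q i) (x i) U) hr
    have hcont : ∀ D : ℝ, Continuous fun U : LGConfig 4 (Matrix.specialUnitaryGroup (Fin 2) ℂ) =>
        Real.exp (((2 : ℕ) : ℝ) * ∑ i ∈ T, carrierCl rF D 1 1 R (q i) (x i) U) := fun D =>
      Real.continuous_exp.comp (continuous_const.mul (continuous_finsetSum _ fun i _ =>
        continuous_const.mul (continuous_classicalResponse (r := rF) _ _ (q i) (x i) 1)))
    exact (torusE_mono rF β L (hcont C') (hcont C) hpt).trans h0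
  -- the (RM) press at the β-free carrier
  have hRM := responseMoments_of_quadratic_and_influence (N := 2) rF Transport.uRec
    (C₁ := C₁ * C' / C_s) (β₁ := β₀) (ℓ₁ := ℓ₀) (A₀ := A₂ + (A₂ + A₃ / C_s)) (p := p)
    (fun _β R q x η => carrierCl rF C' 1 1 R q x η)
    (fun _β R => |(1 : ℝ)| * (R : ℝ) ^ 4 / |C'| * (2 * rF.N))
    (fun _β R q x => measurable_carrierCl (r := rF) C' 1 1 R q x)
    (fun _β R q x η => abs_carrierCl_le (r := rF) C' one_pos 1 R q x η) BlockSize.three (fun _ _ => 3) (fun _ _ => 0)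
    hsplit hEMQ
    (fun β hβ L n q x R hq hR hRa hL hsep T => hEMI β hβ L n q x R hq hR hRa hL hsep T)
  exact ⟨Transport.uRec, 1, C₁ * C' / C_s, _, β₀, ℓ₀, P₀, p, one_pos,
    Filter.Eventually.of_forall fun β => by rw [one_mul], hℓ₀pos, by positivity, hp, hRM⟩

end SU2

end Summit.QuantumFields.YangMills.Cruxes.UVSeamRec.ClassicalResponse

end
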